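import Summits.CriticalPhenomena.PercolationContinuityZ3.Theorems.Transplant.SkelNegBParamsSlotsT
import HarnessLib

/-!
# N1 params, chain of record `NegB`, part RootA: THE SEED'S FINE FOOTPRINT AT THE ROOT — p3-g9's `hkA0/hkA1/hkAQ` with `kA := k + 1`, the chain
# `k ≤ M₀ ≤ M_u ≤ RA′ − 2`, and the y-twin's zone clearance `hclrz`

The seed `Λ t k` has planar footprint `|φ a − φ t| ≤ k`; the fine map of record contracts axis `i` by `c_i·800·L̂_i/D ≤ 1 − 2/D` (`room_fcells_at`), so the fine
footprint is read by `kA := k + 1`, and `kA + 1 = k + 2 ≤ M_u + 2 ≤ RA′ ≤ K(6RA′+11) ≤ r_i ≤ 5r_i` at `g := gT`.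

builds on p205010 (kernel theorem, internal audit signed; external expert review pending) — nothing in this file uses p205010; NOTHING is claimed about
the node `SamePDropOfSkeletonNeg₁` (OPEN).
Lane `prim-bschramm-*`, seat `prim-bschramm-stmt` (gen 14); helper file (`--supports stmt-CriticalPhenomena-4575 --as helper`); ledger HOME/prim-bschramm-stmt/NEG-PARAMS.md v0.13.
* §1 any `(g,f)`: **`hkA0_R`**, **`hkA1_R`** (`kA := D.k + 1`);
* §2 `KS.Mu_add_two_le_RA'` (`M_u + 2 ≤ RA′`, any kit index); at `g := gT mk gx` (any `f`): **`hkAQ_T`** (`∀ i, (k+1) + 1 ≤ 5·r_i`, given `k ≤ M₀`), `RA'_le_r_T`,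
  **`hclrz_T`** (`(M_u+4)(n_L+|h_L|) ≤ n_L(ℓ_L+1)`, the y-twin's zone clearance).
[cite: KozmaNitzan2024, §4 p. 28 ((32) at the root: the seed inside the root cube)] [cite: MartineauTassion2017, §4.3]
-/

noncomputable section

open scoped Classical

namespace Summit.CriticalPhenomena.PercolationContinuityZ3.Theorems.Transplant

namespace PlanarSkeletonNeg

namespace NegB

open Literature.Probability.Percolation Literature.Probability.LatticeModels SimpleGraph
open SkelConc (Consts)
open Skelφ.StepI (DataN)
open Neg

/-! ## §1 The seed's footprint read by `kA := k + 1` -/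

section Seed

variable (κ : Consts) {V : Type} [DecidableEq V] [Countable V] {G : SimpleGraph V} [G.LocallyFinite] (Φ : PlanarSkeletonNeg G) (t : V)
  (p : unitInterval) (D : DataN V) (g f : ℕ)

/-- **`hkA0`** with `kA := k + 1`: `20K s₀·(|800|·(|v_β|+|v_L|)·k) ≤ (k+1)·D` (`c₀·800·L̂₀ + 2 ≤ D`). [folklore] -/
theorem hkA0_R (hN : EqNumL κ Φ t p D g f) :
    20 * ((fcells κ Φ t p D g f).K : ℤ) * (((fcells κ Φ t p D g f).s 0 : ℕ) : ℤ) *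
        (|(800 : ℤ)| * (|Skelφ.NegPrm.vβOf (nL κ Φ t p D g f) (hL κ Φ t p D g f) (ℓL κ Φ t p D g f) (vL κ Φ t p D g f)| + |vL κ Φ t p D g f|) * (D.k : ℤ)) ≤
      ((D.k : ℤ) + 1) * Skelφ.NegPrm.Dof (nL κ Φ t p D g f) (hL κ Φ t p D g f) (ℓL κ Φ t p D g f) (vL κ Φ t p D g f) := by
  have h0 := (room_fcells_at κ Φ t p D g f hN).1
  obtain ⟨hn1, hℓ1⟩ := one_le_of_eqNumL κ Φ t p D g f hN
  have hD : 0 < Skelφ.NegPrm.Dof (nL κ Φ t p D g f) (hL κ Φ t p D g f) (ℓL κ Φ t p D g f) (vL κ Φ t p D g f) := Skelφ.NegPrm.Dof_pos hn1 hℓ1 _ _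
  have e : vβL κ Φ t p D g f = Skelφ.NegPrm.vβOf (nL κ Φ t p D g f) (hL κ Φ t p D g f) (ℓL κ Φ t p D g f) (vL κ Φ t p D g f) := rfl
  rw [e] at h0
  have hk : (0 : ℤ) ≤ D.k := by positivity
  have hX : 0 ≤ 20 * ((fcells κ Φ t p D g f).K : ℤ) * (((fcells κ Φ t p D g f).s 0 : ℕ) : ℤ) *
      (|(800 : ℤ)| * (|Skelφ.NegPrm.vβOf (nL κ Φ t p D g f) (hL κ Φ t p D g f) (ℓL κ Φ t p D g f) (vL κ Φ t p D g f)| + |vL κ Φ t p D g f|)) := by positivity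
  generalize 20 * ((fcells κ Φ t p D g f).K : ℤ) * (((fcells κ Φ t p D g f).s 0 : ℕ) : ℤ) = C at h0 hX ⊢
  generalize |(800 : ℤ)| * (|Skelφ.NegPrm.vβOf (nL κ Φ t p D g f) (hL κ Φ t p D g f) (ℓL κ Φ t p D g f) (vL κ Φ t p D g f)| + |vL κ Φ t p D g f|) = X at h0 hX ⊢
  generalize Skelφ.NegPrm.Dof (nL κ Φ t p D g f) (hL κ Φ t p D g f) (ℓL κ Φ t p D g f) (vL κ Φ t p D g f) = Δ at h0 hD ⊢
  generalize (D.k : ℤ) = k at hk ⊢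
  nlinarith

/-- **`hkA1`** with `kA := k + 1`: `20K s₁·(|800|·(|n_L|+|h_L|)·k) ≤ (k+1)·D`. [folklore] -/
theorem hkA1_R (hN : EqNumL κ Φ t p D g f) :
    20 * ((fcells κ Φ t p D g f).K : ℤ) * (((fcells κ Φ t p D g f).s 1 : ℕ) : ℤ) * (|(800 : ℤ)| * (|((nL κ Φ t p D g f : ℕ) : ℤ)| + |hL κ Φ t p D g f|) * (D.k : ℤ)) ≤
      ((D.k : ℤ) + 1) * Skelφ.NegPrm.Dof (nL κ Φ t p D g f) (hL κ Φ t p D g f) (ℓL κ Φ t p D g f) (vL κ Φ t p D g f) := by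
  have h0 := (room_fcells_at κ Φ t p D g f hN).2
  obtain ⟨hn1, hℓ1⟩ := one_le_of_eqNumL κ Φ t p D g f hN
  have hD : 0 < Skelφ.NegPrm.Dof (nL κ Φ t p D g f) (hL κ Φ t p D g f) (ℓL κ Φ t p D g f) (vL κ Φ t p D g f) := Skelφ.NegPrm.Dof_pos hn1 hℓ1 _ _
  have hk : (0 : ℤ) ≤ D.k := by positivity
  have hX : 0 ≤ 20 * ((fcells κ Φ t p D g f).K : ℤ) * (((fcells κ Φ t p D g f).s 1 : ℕ) : ℤ) * (|(800 : ℤ)| * (|((nL κ Φ t p D g f : ℕ) : ℤ)| + |hL κ Φ t p D g f|)) := by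
    positivity
  generalize 20 * ((fcells κ Φ t p D g f).K : ℤ) * (((fcells κ Φ t p D g f).s 1 : ℕ) : ℤ) = C at h0 hX ⊢
  generalize |(800 : ℤ)| * (|((nL κ Φ t p D g f : ℕ) : ℤ)| + |hL κ Φ t p D g f|) = X at h0 hX ⊢
  generalize Skelφ.NegPrm.Dof (nL κ Φ t p D g f) (hL κ Φ t p D g f) (ℓL κ Φ t p D g f) (vL κ Φ t p D g f) = Δ at h0 hD ⊢
  generalize (D.k : ℤ) = k at hk ⊢
  nlinarith

end Seed

/-! ## §2 `M_u + 2 ≤ RA′`; the seed read inside the root cube; the y-twin's zone clearance -/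

namespace KS

section Chain

variable (κ : Consts) {V : Type} [DecidableEq V] [Countable V] {G : SimpleGraph V} [G.LocallyFinite] (Φ : PlanarSkeletonNeg G) (t : V)
  (p : unitInterval) (D : DataN V) (mk : ℕ)

omit [DecidableEq V] in
/-- **`M_u + 2 ≤ RA′`** (any kit index): `RA′ = j₁A + reachA + 1`, `reachA ≥ KCmax = 11·(Dsh + M_u + 1)`. [folklore] -/
theorem Mu_add_two_le_RA' : Mu D + 2 ≤ RA' κ Φ t p D mk := by
  show Mu D + 2 ≤ j₁A κ Φ t p D mk + (13 * (T₀a t D mk + 1) + 13 * da t D mk + (Dsh t D mk + Mu D + 1) * 11) + 1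
  nlinarith [Nat.zero_le (j₁A κ Φ t p D mk), Nat.zero_le (T₀a t D mk), Nat.zero_le (da t D mk), Nat.zero_le (Dsh t D mk)]

omit [DecidableEq V] in
/-- `D.k + 2 ≤ RA′` once `k ≤ M₀` (`M₀ ≤ M_u`). [folklore] -/
theorem k_add_two_le_RA' (hk : D.k ≤ D.M₀) : D.k + 2 ≤ RA' κ Φ t p D mk := by
  have h1 := Mu_add_two_le_RA' κ Φ t p D mk
  have h2 := M₀_le_Mu D
  omega

end Chain

section AtT

variable (κ : Consts) {V : Type} [DecidableEq V] [Countable V] {G : SimpleGraph V} [G.LocallyFinite] (Φ : PlanarSkeletonNeg G) (t : V)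
  (p : unitInterval) (D : DataN V) (mk : ℕ) (gx : Neg.FSlot) (f : ℕ)

/-- **`RA′ ≤ r_i`** at `g := gT` (`K ≥ 40`, `K(6RA′+11) ≤ r₀`, `K(14RA′+27) ≤ r₁`). [folklore] -/
theorem RA'_le_r_T (hN : EqNumL κ Φ t p D (gT mk gx κ Φ t p D) f) (hκ : (hL κ Φ t p D (gT mk gx κ Φ t p D) f).natAbs ≤ 10 * nL κ Φ t p D (gT mk gx κ Φ t p D) f) :
    ∀ i, (RA' κ Φ t p D mk : ℤ) ≤ ((fcells κ Φ t p D (gT mk gx κ Φ t p D) f).r i : ℤ) := by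
  obtain ⟨h0, h1⟩ := r_geT κ Φ t p D mk gx f hN hκ
  have hK : (40 : ℤ) ≤ Neg.K κ := by exact_mod_cast (Neg.forty_le_K κ).1
  have hR : (0 : ℤ) ≤ (RA' κ Φ t p D mk : ℤ) := by positivity
  intro i
  obtain rfl | rfl : i = 0 ∨ i = 1 := by fin_cases i <;> simp
  · nlinarith
  · nlinarith

/-- **`hkAQ`** with `kA := k + 1`: `(k + 1) + 1 ≤ 5·r_i` for both axes, at `g := gT` (given the seed level `k ≤ M₀`). [folklore] -/
theorem hkAQ_T (hN : EqNumL κ Φ t p D (gT mk gx κ Φ t p D) f) (hκ : (hL κ Φ t p D (gT mk gx κ Φ t p D) f).natAbs ≤ 10 * nL κ Φ t p D (gT mk gx κ Φ t p D) f)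
    (hk : D.k ≤ D.M₀) : ∀ i, (D.k : ℤ) + 1 + 1 ≤ 5 * ((fcells κ Φ t p D (gT mk gx κ Φ t p D) f).r i : ℤ) := by
  intro i
  have h1 := RA'_le_r_T κ Φ t p D mk gx f hN hκ i
  have h2 : ((D.k + 2 : ℕ) : ℤ) ≤ (RA' κ Φ t p D mk : ℤ) := by exact_mod_cast k_add_two_le_RA' κ Φ t p D mk hk
  push_cast at h2
  have h3 : (0 : ℤ) ≤ ((fcells κ Φ t p D (gT mk gx κ Φ t p D) f).r i : ℤ) := by positivity
  linarith

/-- **`hclrz`** (the y-twin's zone clearance) at `g := gT`: `(M_u + 4)(n_L + |h_L|) ≤ n_L(ℓ_L + 1)` (`layer_T` with `M_u + 4 ≤ RA′ + 3`). [folklore] -/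
theorem hclrz_T (hN : EqNumL κ Φ t p D (gT mk gx κ Φ t p D) f) (hκ : (hL κ Φ t p D (gT mk gx κ Φ t p D) f).natAbs ≤ 10 * nL κ Φ t p D (gT mk gx κ Φ t p D) f) :
    ((Mu D : ℤ) + 4) * ((nL κ Φ t p D (gT mk gx κ Φ t p D) f : ℤ) + |hL κ Φ t p D (gT mk gx κ Φ t p D) f|) ≤
      (nL κ Φ t p D (gT mk gx κ Φ t p D) f : ℤ) * ((ℓL κ Φ t p D (gT mk gx κ Φ t p D) f : ℤ) + 1) := by
  have h1 := layer_T κ Φ t p D mk gx f hN hκ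
  have h2 : ((Mu D + 2 : ℕ) : ℤ) ≤ (RA' κ Φ t p D mk : ℤ) := by exact_mod_cast Mu_add_two_le_RA' κ Φ t p D mk
  push_cast [Int.natCast_natAbs] at h1 h2
  have hn : (1 : ℤ) ≤ nL κ Φ t p D (gT mk gx κ Φ t p D) f := by exact_mod_cast (one_le_of_eqNumL κ Φ t p D _ f hN).1
  have hs : (0 : ℤ) ≤ (nL κ Φ t p D (gT mk gx κ Φ t p D) f : ℤ) + |hL κ Φ t p D (gT mk gx κ Φ t p D) f| := by positivity
  nlinarith

end AtT

end KS

end NegB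

end PlanarSkeletonNeg

end Summit.CriticalPhenomena.PercolationContinuityZ3.Theorems.Transplant
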